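import Literature.Probability.RandomPlanarGeometry.SAWLoopErasureKestenRenewalGreenTable
import Literature.Probability.FitznerVanDerHofstad2017.SrwLawBesselEGF
import Literature.NumberTheory.Transcendental.CalegariDimitrovTangL2Chi3Proofs
import HarnessLib

/-!
# Watson's integral to nine places in the kernel and `μ(ℤ³) ≥ 4.475 817`: the HSS93 `(0,1)` bound at full precision,
# by Zagier's recurrence for the cubic return counts and a telescoping tail potential

Hara–Slade–Sokal [HSS93, Table 2 p. 14] print the loop-erasure lower bound of order `(0,1)` for the simple cubic lattice as
`μ(ℤ³) ≥ 4.475 817`; it is the renewal floor `2d/(2 − 1/G_d)` [HSS93, (2.32)–(2.33) p. 11] at the simple-random-walk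
Green function `G₃ = C₀(0,0;1/6) = Σₙ p_{2n}(0) = 1.516 386 059 15…` (Watson's integral) [HSS93, Appendix A.1, Table 4].
The tree's `GreenCert` (`SAWLoopErasureKestenRenewalGreenTable`) certifies `G₃ ≤ 1.5387` by an exact head `Σ_{m<256}` plus a
Chernoff/uniform tail envelope, whence the record `le_connectiveConstant_three_renewal : μ(ℤ³) ≥ 4.444`; in `d = 3` the tail
`Σ_{n ≥ 256} p_{2n}(0) ≈ 0.029` decays only like `N^{-1/2}` and the envelope loses a factor `≈ 1.8` on it.

This file closes the gap to `5 · 10⁻¹⁰` with two exact inputs and no new numerics beyond one more table evaluation: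

* **§1 closed form.** Peeling the kernel recursion `G_succ` three times at the origin and re-indexing the even
  antidiagonal, `c_{2n}(0) = srwCount 3 (2n) 0 = C(2n,n) · Σ_k C(n,k)² C(2k,k) = C(2n,n) · zagierC n`
  (`srwCount_three_origin`; the inner sum is the tree's `CalegariDimitrovTang.zagierC`, the sequence C `1, 3, 15, 93, 639, …`
  of [CDT24, §11.1 p. 101, eq. (zagr) with (A,B,λ) = (10,9,3)]), via the binomial identity
  `C(2n,2i) C(2i,i) C(2(n−i),n−i) = C(2n,n) C(n,i)²` and Vandermonde.
* **§2 ratio majorant.** Zagier's three-term recurrence `(n+2)² uₙ₊₂ = (10n²+30n+23) uₙ₊₁ − 9(n+1)² uₙ` (`zagierC_rec`, in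
  the tree) propagates the one-sided bound `8(n+1)²(2n+1) uₙ₊₁ ≤ 9(2(2n+1)³−1) uₙ` upward from `n = 2` — the closure defect
  clears to `9uₙ₊₁(192n² + 264n + 117) ≥ 0` — i.e. `p_{2n+2}(0) ≤ ρ(n+1) p_{2n}(0)` with
  `ρ(x) = (2(2x−1)³−1)/(16x³) = 1 − 3/(2x) + 3/(4x²) − 3/(16x³)` (`srwLaw_three_succ_le`), matching the local limit
  `p_{2n}(0) ∼ 2(3/(4πn))^{3/2}` to second order.
* **§3 telescoping potential.** With `θ(x) = 2x + 3/(20x) + 1/(2x²)`, `(1 + θ(k+1)) ρ(k+1) ≤ θ(k)` for `k ≥ 1` (defect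
  `12640k⁴ + 33620k³ + 35340k² + 16960k + 3200 ≥ 0`), so `Σ_{K<n≤m} qₙ + θ(m) q_m` is non-increasing and
  `Σ_{n>K} p_{2n}(0) ≤ θ(K) p_{2K}(0)` (`sum_range_le_of_telescopingPotential`, `tsum_srwLaw_three_tail_le`): relative tail
  error `O(K⁻³)` instead of `O(1)`.
* **§4 certificate at `K = 255`.** Head `Σ_{m<256} p_{2m}(0) ≤ 1.487 210 510 748` is the tree's `GreenCert.cert_head_3`
  (cited, not recomputed); the single new kernel evaluation is `p_{510}(0) = partialQ 3 256 − partialQ 3 255 ≤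
  5.720 689 187 880 8 · 10⁻⁵` (`decide +kernel`, two table runs); `θ(255) = 26530231/52020`.

## What is typed (standard axioms; no `sorry`; numerics by `decide +kernel` / `norm_num` in exact rationals)

* `Watson.srwCount_three_origin (n) : srwCount 3 (2n) 0 = C(2n,n) · zagierC n`, `Watson.srwLaw_three_origin`;
* `Watson.zagierC_succ_le`, `Watson.srwLaw_three_succ_le (n ≥ 2) : p_{2n+2}(0) ≤ ρ(n+1) p_{2n}(0)`;
* `Watson.sum_range_le_of_telescopingPotential` (abstract tail lemma), `Watson.tsum_srwLaw_three_tail_le`;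
* **`Watson.srwI_three_le : G₃ = srwI 3 1 0 0 ≤ 1.516 386 059 7`** (true `1.516 386 059 15`; tree record `1.5387`);
* **`Watson.le_connectiveConstant_three_potential : 4.475 817 171 ≤ μ(ℤ³)`** and
  **`Watson.le_connectiveConstant_three_hss : 4.475 817 ≤ μ(ℤ³)`** — HSS93's printed `(0,1)` value for `d = 3`
  (exact floor `4.475 817 172 5…`); the tree's lower-bound record for `ℤ³` was `4.444` (`le_connectiveConstant_three_renewal`;
  bridges: `4.27`).  HSS93's best three-dimensional bound `4.572 140` (order `(2̃,1)`/`(2̃,2)`) needs the off-origin Green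
  function and is not attempted here.

Reproduction (no search; every certificate is a univariate polynomial identity checked by `ring`/`linear_combination` and a
sign check by `positivity`): the two defect polynomials above; `u₂ = 15`, `u₃ = 93` (base); the rationals of §4.
-/

namespace Literature.Probability.RandomPlanarGeometry.SAW.Zd.LoopErasure

open Finset
open Literature.Barriers.CriticalPhenomena.LongRangePhi4 (srwLaw srwLaw_nonneg)
open Literature.Probability.FitznerVanDerHofstad2017
open Literature.Probability.FitznerVanDerHofstad2017.SrwCount (coordD G G_succ G_zero srwCount srwLaw_eq_srwCount_div
  walk1 walk1_closed walk1_nat_eq_zero_of_odd)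
open Literature.NumberTheory.Transcendental.CalegariDimitrovTang (zagierC zagierC_rec zagierC_two zagierC_three)

namespace Watson

/-! ### §1 The cubic return counts `c_{2n}(0) = C(2n,n) · Σ_k C(n,k)² C(2k,k)` -/

/-- The origin of `ℤ³` has all coordinates `0`.
[cite: HaraSladeSokal1993, Appendix A.1 pp. 28–30 (the simple-random-walk kernel behind C₀(0,0;1/2d))] -/
theorem coordD_origin_three (j : ℕ) : coordD (0 : Fin 3 → ℤ) j = 0 := by
  simp [coordD]

/-- `walk1 (2i) 0 = C(2i, i)` (closed `±1` walks).
[cite: HaraSladeSokal1993, Appendix A.1 pp. 28–30 (the simple-random-walk kernel behind C₀(0,0;1/2d))] -/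
theorem walk1_even_zero (i : ℕ) : walk1 (2 * i) 0 = (2 * i).choose i := by
  have h := walk1_closed (2 * i) i 0 (by ring)
  simpa using h

/-- `walk1 (2i+1) 0 = 0` (parity).
[cite: HaraSladeSokal1993, Appendix A.1 pp. 28–30 (the simple-random-walk kernel behind C₀(0,0;1/2d))] -/
theorem walk1_odd_zero (i : ℕ) : walk1 (2 * i + 1) 0 = 0 := by
  have h := walk1_nat_eq_zero_of_odd (2 * i + 1) 0 (by omega)
  simpa using h

/-- A sum over the antidiagonal of `2n` whose summand vanishes at odd first index is the sum over the even points
`(2i, 2(n − i))`, `i ≤ n`.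
[cite: HaraSladeSokal1993, Appendix A.1 pp. 28–30 (the simple-random-walk kernel behind C₀(0,0;1/2d))] -/
theorem sum_antidiagonal_two_mul_of_odd_eq_zero (n : ℕ) (f : ℕ → ℕ → ℕ) (hf : ∀ i b, f (2 * i + 1) b = 0) :
    ∑ ij ∈ antidiagonal (2 * n), f ij.1 ij.2 = ∑ i ∈ range (n + 1), f (2 * i) (2 * (n - i)) := by
  rw [Finset.Nat.sum_antidiagonal_eq_sum_range_succ]
  -- split `range (2n+1)` into even and odd indices
  have key : ∀ m : ℕ, ∑ k ∈ range (2 * m + 1), f k (2 * n - k) =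
      ∑ i ∈ range (m + 1), f (2 * i) (2 * n - 2 * i) + ∑ i ∈ range m, f (2 * i + 1) (2 * n - (2 * i + 1)) := by
    intro m
    induction m with
    | zero => simp
    | succ m ih =>
        rw [show 2 * (m + 1) + 1 = 2 * m + 1 + 1 + 1 by ring, sum_range_succ, sum_range_succ, ih,
          sum_range_succ (fun i => f (2 * i) (2 * n - 2 * i)) (m + 1), sum_range_succ (fun i => f (2 * i + 1) _) m,
          show 2 * (m + 1) = 2 * m + 1 + 1 by ring]
        ring
  rw [Nat.succ_eq_add_one, key n]
  have hz : ∑ i ∈ range n, f (2 * i + 1) (2 * n - (2 * i + 1)) = 0 :=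
    sum_eq_zero fun i _ => hf i _
  rw [hz, add_zero]
  refine sum_congr rfl fun i hi => ?_
  congr 1
  have : i ≤ n := Nat.lt_succ_iff.mp (mem_range.mp hi)
  omega

/-- Dimension one: `G 0 1 m = walk1 m 0`.
[cite: HaraSladeSokal1993, Appendix A.1 pp. 28–30 (the simple-random-walk kernel behind C₀(0,0;1/2d))] -/
theorem G_one_origin (m : ℕ) : G (0 : Fin 3 → ℤ) 1 m = walk1 m 0 := by
  rw [G_succ, coordD_origin_three]
  rw [Finset.sum_eq_single ⟨m, 0⟩]
  · simp
  · intro ij hij hne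
    have hsum : ij.1 + ij.2 = m := Finset.HasAntidiagonal.mem_antidiagonal.mp hij
    have h2 : ij.2 ≠ 0 := by
      intro h0
      apply hne
      ext <;> simp <;> omega
    simp [G_zero, h2]
  · intro h
    exact absurd (Finset.HasAntidiagonal.mem_antidiagonal.mpr (by simp)) h

/-- The binomial triple-product identity `C(2n,2i) C(2i,i) C(2(n−i), n−i) = C(2n,n) C(n,i)²`, `i ≤ n`.
[cite: BorweinEtAl2012, §1 eq. (1.1) (W₃(2k) = Σ C(k,i)² C(2i,i)); HaraSladeSokal1993, Appendix A.1 pp. 28–30] -/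
theorem choose_triple (n i : ℕ) (hi : i ≤ n) :
    (2 * n).choose (2 * i) * (2 * i).choose i * (2 * (n - i)).choose (n - i) =
      (2 * n).choose n * n.choose i ^ 2 := by
  -- (a) C(2n,2i) C(2i,i) = C(2n,i) C(2n−i,i)
  have ha : (2 * n).choose (2 * i) * (2 * i).choose i = (2 * n).choose i * (2 * n - i).choose i := by
    have h := Nat.choose_mul (n := 2 * n) (k := 2 * i) (s := i) (by omega)
    rwa [show 2 * i - i = i by omega] at h
  -- (b) C(2n−i, 2(n−i)) C(2(n−i), n−i) = C(2n−i, n−i) C(n, n−i), and C(2n−i, 2(n−i)) = C(2n−i, i)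
  have hb : (2 * n - i).choose i * (2 * (n - i)).choose (n - i) = (2 * n - i).choose (n - i) * n.choose i := by
    have h := Nat.choose_mul (n := 2 * n - i) (k := 2 * (n - i)) (s := n - i) (by omega)
    rw [show 2 * n - i - (n - i) = n by omega, show 2 * (n - i) - (n - i) = n - i by omega] at h
    have hs : (2 * n - i).choose (2 * (n - i)) = (2 * n - i).choose i := by
      rw [show 2 * (n - i) = (2 * n - i) - i by omega]
      exact Nat.choose_symm (by omega)
    rw [hs] at h
    rw [h, Nat.choose_symm hi]
  -- (c) C(2n,n) C(n,i) = C(2n,i) C(2n−i, n−i)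
  have hc : (2 * n).choose n * n.choose i = (2 * n).choose i * (2 * n - i).choose (n - i) := by
    have h := Nat.choose_mul (n := 2 * n) (k := n) (s := i) hi
    exact h
  calc (2 * n).choose (2 * i) * (2 * i).choose i * (2 * (n - i)).choose (n - i)
      = (2 * n).choose i * ((2 * n - i).choose i * (2 * (n - i)).choose (n - i)) := by rw [ha, mul_assoc]
    _ = (2 * n).choose i * (2 * n - i).choose (n - i) * n.choose i := by rw [hb, mul_assoc]
    _ = (2 * n).choose n * n.choose i ^ 2 := by rw [← hc, sq, mul_assoc]

/-- Dimension two: `G 0 2 (2n) = C(2n,n)²` (closed `2n`-step walks on `ℤ²`).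
[cite: HaraSladeSokal1993, Appendix A.1 pp. 28–30 (the simple-random-walk kernel behind C₀(0,0;1/2d))] -/
theorem G_two_origin (n : ℕ) : G (0 : Fin 3 → ℤ) 2 (2 * n) = (2 * n).choose n ^ 2 := by
  rw [G_succ, coordD_origin_three]
  rw [sum_antidiagonal_two_mul_of_odd_eq_zero n (fun a b => (2 * n).choose a * (walk1 a 0 * G (0 : Fin 3 → ℤ) 1 b))
    (fun i b => by rw [walk1_odd_zero, zero_mul, mul_zero])]
  simp_rw [G_one_origin, walk1_even_zero]
  calc ∑ i ∈ range (n + 1), (2 * n).choose (2 * i) * ((2 * i).choose i * (2 * (n - i)).choose (n - i))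
      = ∑ i ∈ range (n + 1), (2 * n).choose n * n.choose i ^ 2 := by
        refine sum_congr rfl fun i hi => ?_
        rw [← mul_assoc, choose_triple n i (Nat.lt_succ_iff.mp (mem_range.mp hi))]
    _ = (2 * n).choose n ^ 2 := by rw [← mul_sum, Nat.sum_range_choose_sq, sq]

/-- **Dimension three: `c_{2n}(0) = G 0 3 (2n) = C(2n,n) · Σ_{k ≤ n} C(n,k)² C(2k,k)`** — the cubic-lattice return counts
`1, 6, 90, 1860, 44730, …` are the central binomials times Zagier's sequence C `1, 3, 15, 93, 639, …` (the tree's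
`CalegariDimitrovTang.zagierC`).
[cite: BorweinEtAl2012, §1 eq. (1.1) (W₃(2k) = Σ C(k,i)² C(2i,i)); HaraSladeSokal1993, Appendix A.1 pp. 28–30] -/
theorem G_three_origin (n : ℕ) : G (0 : Fin 3 → ℤ) 3 (2 * n) = (2 * n).choose n * zagierC n := by
  rw [G_succ, coordD_origin_three]
  rw [sum_antidiagonal_two_mul_of_odd_eq_zero n (fun a b => (2 * n).choose a * (walk1 a 0 * G (0 : Fin 3 → ℤ) 2 b))
    (fun i b => by rw [walk1_odd_zero, zero_mul, mul_zero])]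
  simp_rw [G_two_origin, walk1_even_zero]
  calc ∑ i ∈ range (n + 1), (2 * n).choose (2 * i) * ((2 * i).choose i * (2 * (n - i)).choose (n - i) ^ 2)
      = ∑ i ∈ range (n + 1), (2 * n).choose n * (n.choose i ^ 2 * (2 * (n - i)).choose (n - i)) := by
        refine sum_congr rfl fun i hi => ?_
        rw [sq ((2 * (n - i)).choose (n - i)), ← mul_assoc, ← mul_assoc,
          choose_triple n i (Nat.lt_succ_iff.mp (mem_range.mp hi))]
        ring
    _ = (2 * n).choose n * zagierC n := by
        rw [← mul_sum, zagierC]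
        congr 1
        rw [← sum_range_reflect]
        refine sum_congr rfl fun i hi => ?_
        have hi' : i ≤ n := Nat.lt_succ_iff.mp (mem_range.mp hi)
        rw [show n + 1 - 1 - i = n - i by omega, Nat.choose_symm hi', show n - (n - i) = i by omega]

/-- **`c_{2n}(0) = C(2n,n) · zagierC n` for the tree's `srwCount 3`.**
[cite: BorweinEtAl2012, §1 eq. (1.1) (W₃(2k) = Σ C(k,i)² C(2i,i)); HaraSladeSokal1993, Appendix A.1 pp. 28–30] -/
theorem srwCount_three_origin (n : ℕ) : srwCount 3 (2 * n) (0 : Fin 3 → ℤ) = (2 * n).choose n * zagierC n :=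
  G_three_origin n

/-- **The return probabilities of `ℤ³`: `p_{2n}(0) = C(2n,n) · zagierC n / 36ⁿ`.**
[cite: BorweinEtAl2012, §1 eq. (1.1) (W₃(2k) = Σ C(k,i)² C(2i,i)); HaraSladeSokal1993, Appendix A.1 pp. 28–30] -/
theorem srwLaw_three_origin (n : ℕ) :
    srwLaw 3 (2 * n) 0 = ((2 * n).choose n : ℝ) * (zagierC n : ℝ) / 36 ^ n := by
  rw [srwLaw_eq_srwCount_div, srwCount_three_origin]
  push_cast
  congr 1
  rw [pow_mul]
  norm_num

/-! ### §2 The ratio majorant from Zagier's recurrence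

`(n+2)² uₙ₊₂ = (10n² + 30n + 23) uₙ₊₁ − 9(n+1)² uₙ` (`zagierC_rec`) propagates the one-sided ratio bound
`8(n+1)²(2n+1) uₙ₊₁ ≤ 9(2(2n+1)³ − 1) uₙ` upward from `n = 2`: the closure defect is the identity
`9A (9A′uₙ₊₁ − 8(n+2)²(2n+3) uₙ₊₂) = 9 uₙ₊₁ (192n² + 264n + 117) + 72(2n+3)(n+1)² (9A uₙ − 8(n+1)²(2n+1) uₙ₊₁)`,
`A = 2(2n+1)³ − 1`, `A′ = 2(2n+3)³ − 1`.  In terms of `p_{2n}(0) = C(2n,n) uₙ / 36ⁿ` this is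
`p_{2n+2}(0) ≤ ρ(n+1) p_{2n}(0)` with `ρ(x) = (2(2x−1)³ − 1)/(16x³) = 1 − 3/(2x) + 3/(4x²) − 3/(16x³)`, whose expansion
matches the local limit `p_{2n}(0) ∼ 2 (3/(4πn))^{3/2}` to second order. -/

/-- **One-sided ratio bound for Zagier's sequence C:** `8(n+1)²(2n+1) · uₙ₊₁ ≤ 9(2(2n+1)³ − 1) · uₙ` for `n ≥ 2`.
[cite: CalegariDimitrovTang2024, §11.1, eq. (zagr) with (A,B,λ) = (10,9,3) (p. 101); lane certificate] -/
theorem zagierC_succ_le (n : ℕ) (hn : 2 ≤ n) :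
    8 * ((n : ℝ) + 1) ^ 2 * (2 * n + 1) * (zagierC (n + 1) : ℝ) ≤ 9 * (2 * (2 * (n : ℝ) + 1) ^ 3 - 1) * (zagierC n : ℝ) := by
  induction n, hn using Nat.le_induction with
  | base =>
      rw [show (2 : ℕ) + 1 = 3 from rfl, zagierC_two, zagierC_three]
      norm_num
  | succ n hn ih =>
      have hrecR : ((n : ℝ) + 2) ^ 2 * (zagierC (n + 2) : ℝ) - (10 * ((n : ℝ) + 1) ^ 2 + 10 * ((n : ℝ) + 1) + 3) *
          (zagierC (n + 1) : ℝ) + 9 * ((n : ℝ) + 1) ^ 2 * (zagierC n : ℝ) = 0 := by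
        exact_mod_cast zagierC_rec n
      have hA : (0 : ℝ) < 2 * (2 * (n : ℝ) + 1) ^ 3 - 1 := by nlinarith [sq_nonneg (n : ℝ), (Nat.cast_nonneg n : (0 : ℝ) ≤ n)]
      have hpos : (0 : ℝ) ≤ 9 * (zagierC (n + 1) : ℝ) * (192 * (n : ℝ) ^ 2 + 264 * n + 117) +
          72 * (2 * (n : ℝ) + 3) * ((n : ℝ) + 1) ^ 2 *
            (9 * (2 * (2 * (n : ℝ) + 1) ^ 3 - 1) * (zagierC n : ℝ) - 8 * ((n : ℝ) + 1) ^ 2 * (2 * n + 1) * (zagierC (n + 1) : ℝ)) :=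
        add_nonneg (by positivity) (mul_nonneg (by positivity) (sub_nonneg.2 ih))
      have idt : 9 * (2 * (2 * (n : ℝ) + 1) ^ 3 - 1) *
          (9 * (2 * (2 * ((n : ℝ) + 1) + 1) ^ 3 - 1) * (zagierC (n + 1) : ℝ) -
            8 * ((n : ℝ) + 1 + 1) ^ 2 * (2 * ((n : ℝ) + 1) + 1) * (zagierC (n + 1 + 1) : ℝ)) =
          9 * (zagierC (n + 1) : ℝ) * (192 * (n : ℝ) ^ 2 + 264 * n + 117) +
          72 * (2 * (n : ℝ) + 3) * ((n : ℝ) + 1) ^ 2 *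
            (9 * (2 * (2 * (n : ℝ) + 1) ^ 3 - 1) * (zagierC n : ℝ) - 8 * ((n : ℝ) + 1) ^ 2 * (2 * n + 1) * (zagierC (n + 1) : ℝ)) := by
        rw [show n + 1 + 1 = n + 2 by ring]
        linear_combination (-72 * (2 * (n : ℝ) + 3) * (2 * (2 * (n : ℝ) + 1) ^ 3 - 1)) * hrecR
      rw [← idt] at hpos
      push_cast
      exact sub_nonneg.1 ((mul_nonneg_iff_of_pos_left (by positivity)).1 hpos)

/-- The ratio majorant `ρ(x) = (2(2x−1)³ − 1)/(16x³) = 1 − 3/(2x) + 3/(4x²) − 3/(16x³)`.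
[cite: HaraSladeSokal1993, Appendix A.1 pp. 28–30 (tail of C₀(0,0;1/2d)); lane certificate] -/
noncomputable def cubicReturnRatio (x : ℝ) : ℝ := (2 * (2 * x - 1) ^ 3 - 1) / (16 * x ^ 3)

/-- **Ratio bound for the cubic return probabilities:** `p_{2n+2}(0) ≤ ρ(n+1) · p_{2n}(0)` for `n ≥ 2`.
[cite: CalegariDimitrovTang2024, §11.1, eq. (zagr) with (A,B,λ) = (10,9,3) (p. 101); lane certificate] -/
theorem srwLaw_three_succ_le (n : ℕ) (hn : 2 ≤ n) :
    srwLaw 3 (2 * (n + 1)) 0 ≤ cubicReturnRatio ((n : ℝ) + 1) * srwLaw 3 (2 * n) 0 := by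
  have hu := zagierC_succ_le n hn
  have hnat : (n + 1) * (2 * (n + 1)).choose (n + 1) = 2 * (2 * n + 1) * (2 * n).choose n := by
    have h := Nat.succ_mul_centralBinom_succ n
    simpa [Nat.centralBinom_eq_two_mul_choose] using h
  have hC : ((2 * (n + 1)).choose (n + 1) : ℝ) = 2 * (2 * n + 1) / ((n : ℝ) + 1) * ((2 * n).choose n : ℝ) := by
    have h := congrArg (fun k : ℕ => (k : ℝ)) hnat
    push_cast at h
    rw [div_mul_eq_mul_div, eq_div_iff (by positivity)]
    linarith
  rw [srwLaw_three_origin, srwLaw_three_origin, hC, cubicReturnRatio, ← sub_nonneg]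
  have key : (2 * (2 * ((n : ℝ) + 1) - 1) ^ 3 - 1) / (16 * ((n : ℝ) + 1) ^ 3) * (((2 * n).choose n : ℝ) * (zagierC n : ℝ) / 36 ^ n) -
      2 * (2 * n + 1) / ((n : ℝ) + 1) * ((2 * n).choose n : ℝ) * (zagierC (n + 1) : ℝ) / 36 ^ (n + 1) =
      ((2 * n).choose n : ℝ) / 36 ^ n / (144 * ((n : ℝ) + 1) ^ 3) *
        (9 * (2 * (2 * (n : ℝ) + 1) ^ 3 - 1) * (zagierC n : ℝ) - 8 * ((n : ℝ) + 1) ^ 2 * (2 * n + 1) * (zagierC (n + 1) : ℝ)) := by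
    field_simp
    ring
  rw [key]
  exact mul_nonneg (by positivity) (sub_nonneg.2 hu)

/-! ### §3 The telescoping potential

With `θ(x) = 2x + 3/(20x) + 1/(2x²)` one has `(1 + θ(k+1)) ρ(k+1) ≤ θ(k)` for every `k ≥ 1` (the defect clears to
`12640k⁴ + 33620k³ + 35340k² + 16960k + 3200 ≥ 0`), so `Φ_m = Σ_{K<n≤m} qₙ + θ(m) q_m` is non-increasing along any
non-negative sequence with `qₙ₊₁ ≤ ρ(n+1) qₙ`, whence `Σ_{n>K} qₙ ≤ θ(K) q_K`: a tail bound with relative error `O(K⁻³)`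
in place of the `O(1)` Chernoff-plus-uniform envelope of the tree's `GreenCert`. -/

/-- The potential weight `θ(x) = 2x + 3/(20x) + 1/(2x²)`.
[cite: HaraSladeSokal1993, Appendix A.1 pp. 28–30 (tail of C₀(0,0;1/2d)); lane certificate] -/
noncomputable def cubicTailWeight (x : ℝ) : ℝ := 2 * x + 3 / (20 * x) + 1 / (2 * x ^ 2)

/-- The potential decreases: `(1 + θ(k+1)) · ρ(k+1) ≤ θ(k)` for `k ≥ 1`.
[cite: HaraSladeSokal1993, Appendix A.1 pp. 28–30 (tail of C₀(0,0;1/2d)); lane certificate] -/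
theorem one_add_cubicTailWeight_mul_cubicReturnRatio_le (k : ℕ) (hk : 1 ≤ k) :
    (1 + cubicTailWeight ((k : ℝ) + 1)) * cubicReturnRatio ((k : ℝ) + 1) ≤ cubicTailWeight k := by
  have hk' : (1 : ℝ) ≤ k := by exact_mod_cast hk
  rw [cubicTailWeight, cubicTailWeight, cubicReturnRatio, ← sub_nonneg]
  have key : 2 * (k : ℝ) + 3 / (20 * k) + 1 / (2 * (k : ℝ) ^ 2) -
      (1 + (2 * ((k : ℝ) + 1) + 3 / (20 * ((k : ℝ) + 1)) + 1 / (2 * ((k : ℝ) + 1) ^ 2))) *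
        ((2 * (2 * ((k : ℝ) + 1) - 1) ^ 3 - 1) / (16 * ((k : ℝ) + 1) ^ 3)) =
      (12640 * (k : ℝ) ^ 4 + 33620 * (k : ℝ) ^ 3 + 35340 * (k : ℝ) ^ 2 + 16960 * k + 3200) /
        (6400 * (k : ℝ) ^ 2 * ((k : ℝ) + 1) ^ 5) := by
    field_simp
    ring
  rw [key]
  positivity

/-- **Telescoping tail lemma.** If `0 ≤ qₘ`, `qₘ₊₁ ≤ ρ(m+1) qₘ` and `(1 + θ(m+1)) ρ(m+1) ≤ θ(m)`, `0 ≤ θ(m+1)` for all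
`m ≥ K`, then every partial sum of the tail after `K` is at most `θ(K) q_K`.
[cite: HaraSladeSokal1993, Appendix A.1 pp. 28–30 (tail of C₀(0,0;1/2d)); lane certificate] -/
theorem sum_range_le_of_telescopingPotential {q r t : ℕ → ℝ} (K : ℕ) (hq : ∀ m, 0 ≤ q m) (ht : ∀ m, K ≤ m → 0 ≤ t m)
    (hr : ∀ m, K ≤ m → q (m + 1) ≤ r (m + 1) * q m) (hc : ∀ m, K ≤ m → (1 + t (m + 1)) * r (m + 1) ≤ t m) (M : ℕ) :
    ∑ j ∈ range M, q (K + 1 + j) ≤ t K * q K := by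
  have hΦ : ∀ M, ∑ j ∈ range M, q (K + 1 + j) + t (K + M) * q (K + M) ≤ t K * q K := by
    intro M
    induction M with
    | zero => simp
    | succ M ih =>
        have hKM : K ≤ K + M := Nat.le_add_right K M
        have hstep : (1 + t (K + M + 1)) * q (K + M + 1) ≤ t (K + M) * q (K + M) :=
          calc (1 + t (K + M + 1)) * q (K + M + 1) ≤ (1 + t (K + M + 1)) * (r (K + M + 1) * q (K + M)) :=
                mul_le_mul_of_nonneg_left (hr _ hKM) (by linarith [ht (K + M + 1) (by omega)])
            _ = (1 + t (K + M + 1)) * r (K + M + 1) * q (K + M) := by ring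
            _ ≤ t (K + M) * q (K + M) := mul_le_mul_of_nonneg_right (hc _ hKM) (hq _)
        rw [sum_range_succ, show K + 1 + M = K + M + 1 by ring, show K + (M + 1) = K + M + 1 by ring]
        linarith
  have h := hΦ M
  have h0 : 0 ≤ t (K + M) * q (K + M) := mul_nonneg (ht _ (Nat.le_add_right K M)) (hq _)
  linarith

/-! ### §4 The certificate at `K = 255`: `G₃ ≤ 1.516 386 059 7` and `μ(ℤ³) ≥ 4.475 817 171` -/

/-- `θ ≥ 0` on `ℕ`.
[cite: HaraSladeSokal1993, Appendix A.1 pp. 28–30 (tail of C₀(0,0;1/2d)); lane certificate] -/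
theorem cubicTailWeight_natCast_nonneg (m : ℕ) : 0 ≤ cubicTailWeight m := by
  unfold cubicTailWeight
  positivity

/-- Exact head, from the tree: `Σ_{m<256} p_{2m}(0) ≤ 1.487 210 510 748` (`GreenCert.cert_head_3`).
[cite: HaraSladeSokal1993, Appendix A.1 Table 4 p. 30 (C₀(0,0;1/2d)); lane certificate] -/
theorem partialQ_three_256_le : GreenCert.partialQ 3 256 ≤ 371802627687 / 250000000000 := by
  simpa [GreenCert.cert] using GreenCert.cert_head_3

/-- Exact last head term, evaluated in the kernel with the tree's renewal-table recursion:
`p_{510}(0) = Σ_{m<256} p_{2m}(0) − Σ_{m<255} p_{2m}(0) ≤ 7150861484851 · 10⁻¹⁷ / 1.25` (true value `5.720 689 187 9 · 10⁻⁵`).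
[cite: HaraSladeSokal1993, Appendix A.1 Table 4 p. 30 (C₀(0,0;1/2d)); lane certificate] -/
theorem partialQ_three_256_sub_le :
    GreenCert.partialQ 3 256 - GreenCert.partialQ 3 255 ≤ 7150861484851 / 125000000000000000 := by
  decide +kernel

/-- `p_{510}(0) ≤ 5.720 689 187 880 8 · 10⁻⁵`.
[cite: HaraSladeSokal1993, Appendix A.1 pp. 28–30 (tail of C₀(0,0;1/2d)); lane certificate] -/
theorem srwLaw_three_510_le : srwLaw 3 (2 * 255) 0 ≤ (7150861484851 / 125000000000000000 : ℝ) := by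
  have h := (Rat.cast_le (K := ℝ)).2 partialQ_three_256_sub_le
  have hcast : ((GreenCert.partialQ 3 256 - GreenCert.partialQ 3 255 : ℚ) : ℝ) = srwLaw 3 (2 * 255) 0 := by
    push_cast
    rw [GreenCert.partialQ_cast, GreenCert.partialQ_cast, sum_range_succ]
    ring
  rw [hcast] at h
  push_cast at h
  exact h

/-- **Tail bound by the telescoping potential:** `Σ_{n ≥ 256} p_{2n}(0) ≤ θ(255) · p_{510}(0)`.
[cite: CalegariDimitrovTang2024, §11.1, eq. (zagr) with (A,B,λ) = (10,9,3) (p. 101); lane certificate] -/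
theorem tsum_srwLaw_three_tail_le : ∑' j, srwLaw 3 (2 * (256 + j)) 0 ≤ cubicTailWeight 255 * srwLaw 3 (2 * 255) 0 := by
  have hq : ∀ m, 0 ≤ srwLaw 3 (2 * m) 0 := fun m => srwLaw_nonneg _ _
  refine Real.tsum_le_of_sum_range_le (fun j => hq _) (fun M => ?_)
  have h := sum_range_le_of_telescopingPotential (q := fun m => srwLaw 3 (2 * m) 0) (r := fun m => cubicReturnRatio m)
    (t := fun m => cubicTailWeight m) 255
    hq (fun m _ => cubicTailWeight_natCast_nonneg m)
    (fun m hm => by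
      have h := srwLaw_three_succ_le m (by omega)
      push_cast
      exact h)
    (fun m hm => by
      have h := one_add_cubicTailWeight_mul_cubicReturnRatio_le m (by omega)
      push_cast
      exact h) M
  simpa using h

/-- **Watson's integral to nine places in the kernel: `G₃ = C₀(0,0;1/6) = Σₙ p_{2n}(0) ≤ 1.516 386 059 7`**
(true value `1.516 386 059 15…`; the tree's `GreenCert.srwI_one_le_certB_three` gives `1.5387`).
[cite: HaraSladeSokal1993, Appendix A.1 Table 4 p. 30 (C₀(0,0;1/2d), d = 3); lane certificate] -/
theorem srwI_three_le : srwI 3 1 0 0 ≤ (15163860597 / 10 ^ 10 : ℝ) := by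
  have hsplit := GreenCert.srwI_one_eq_sum_add_tsum (d := 3) (by norm_num) 256
  have hhead : ∑ m ∈ range 256, srwLaw 3 (2 * m) 0 ≤ (371802627687 / 250000000000 : ℝ) := by
    rw [← GreenCert.partialQ_cast]
    have h := (Rat.cast_le (K := ℝ)).2 partialQ_three_256_le
    push_cast at h
    exact h
  have htail := tsum_srwLaw_three_tail_le
  have hlast := srwLaw_three_510_le
  have hθ : cubicTailWeight 255 = (26530231 / 52020 : ℝ) := by norm_num [cubicTailWeight]
  have hθ0 : (0 : ℝ) ≤ cubicTailWeight 255 := by rw [hθ]; norm_num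
  have htail' : ∑' j, srwLaw 3 (2 * (256 + j)) 0 ≤ 26530231 / 52020 * (7150861484851 / 125000000000000000 : ℝ) :=
    le_trans htail (by rw [hθ]; exact mul_le_mul_of_nonneg_left hlast (by norm_num))
  rw [hsplit]
  have : (371802627687 / 250000000000 : ℝ) + 26530231 / 52020 * (7150861484851 / 125000000000000000 : ℝ) ≤
      15163860597 / 10 ^ 10 := by norm_num
  linarith

/-- **`μ(ℤ³) ≥ 4.475 817 171`** by the renewal floor `2d/(2 − 1/G_d)` at the kernel-certified `G₃ ≤ 1.516 386 059 7` — the full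
printed precision of HSS93's `(0,1)` bound `4.475 817` (exact value `4.475 817 172 5…`); the tree's record was `4.444`.
[cite: HaraSladeSokal1993, (2.32)–(2.33) p. 11; Table 2 p. 14 row (0,1), d = 3: 4.475 817; lane certificate] -/
theorem le_connectiveConstant_three_potential : (4475817171 / 10 ^ 9 : ℝ) ≤ connectiveConstant 3 := by
  refine le_trans ?_ (two_mul_div_renewal_le_connectiveConstant_of_le (by norm_num) srwI_three_le)
  norm_num

/-- **`μ(ℤ³) ≥ 4.475 817`** — HSS93's printed loop-erasure bound of order `(0,1)` in three dimensions, now kernel-checked.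
[cite: HaraSladeSokal1993, Table 2 p. 14 row (0,1), d = 3: 4.475 817; lane certificate] -/
theorem le_connectiveConstant_three_hss : (4475817 / 10 ^ 6 : ℝ) ≤ connectiveConstant 3 :=
  le_trans (by norm_num) le_connectiveConstant_three_potential

end Watson

end Literature.Probability.RandomPlanarGeometry.SAW.Zd.LoopErasure
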